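import Literature.InformationTheory.QuantumCodes.HyperbicycleCodes
import Literature.InformationTheory.QuantumCodes.QuasiAbelianLPDistance
import Literature.InformationTheory.QuantumCodes.HypergraphProductSectorDistances
import Literature.InformationTheory.Coding.SubfieldImage
import HarnessLib

/-!
# Kovalev–Pryadko 2013, Consequence 4 and Theorem 5: the general distance lower bound `D ≥ ⌊d/c⌋` for
# hyperbicycle codes, PROVED for the tree's `Hyperbicycle.code a b χ`

A. A. Kovalev, L. P. Pryadko, *Quantum Kronecker sum-product LDPC codes with finite rate*, PRA **88**,
012311 (2013) = arXiv:1212.6703 [KovalevPryadko2013Hyperbicycle], §IV.B–C (held text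
`paper:arxiv-1212.6703`, chunks p0009 L50–75, p0011 L72–99), read on the page:

> (22) `ℋ₁ = Σᵢ Iᵢ^(χ) ⊗ aᵢ`, `ℋ₂ = Σᵢ bᵢ ⊗ Iᵢ^(χ)`, `ℋ̃₁ = Σᵢ Ĩᵢ^(χ) ⊗ aᵢᵀ`, `ℋ̃₂ = Σᵢ bᵢᵀ ⊗ Ĩᵢ^(χ)`
> ("tiled" binary matrices).
> **Consequence 4.** A quantum CSS code with generators (19) can only have `K > 0` if at least one of the
> binary codes with the parity check matrices (22) is non-empty.
> **Theorem 5.** The minimum distance of the code with generators (19) satisfies the lower bound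
> `D ≥ ⌊d/c⌋`, `d ≡ min(d₁, d₂, d̃₁, d̃₂)`.

The tree's `Hyperbicycle.code a b χ` (`HyperbicycleCodes.lean`) carries the block-shift twist `I_{χi}` on the
`b`-block; `Hyperbicycle.isLiftedProduct` (`TwoBlockLiftedProduct.lean`) showed abstractly (an `∃` over
`Fin`-reindexings) that it is a quasi-cyclic lifted-product code `LP(A, B_χ)` with circulant blocks
`A_{uv} = Σᵢ (aᵢ)_{uv} xⁱ`, `(B_χ)_{βν} = Σᵢ (bᵢ)_{βν} x^{χi}`. This file makes the identification CONCRETE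
(explicit index bijections, `xMatrix_submatrix` / `zMatrix_submatrix`) and transports the quasi-abelian
Statement 12 / Lemma 16 of `QuasiAbelianLPDistance.lean` (Lin–Pryadko 2024, there proved for all
quasi-abelian `LP(A,B)` over `F[N]`, char 2) to hyperbicycle codes, for EVERY twist `χ`:

* `tiledA a = Σᵢ Iᵢ ⊗ aᵢ` and `tiledB b χ = Σᵢ bᵢ ⊗ I_{χi}` — the tiled matrices (22) in the tree's twist
  convention (for `χ = 1` literally the printed `ℋ₁`, `ℋ₂`; `tiledA_eq_kronecker`, `tiledB_eq_kronecker`);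
  their transposes play `ℋ̃₁`, `ℋ̃₂` (same kernels' distances as the printed `Ĩ`-versions, which differ by
  row/column permutations only);
* **`k_eq_zero_of_pcCode_tiled_eq_bot`** (Consequence 4, sharpened as Lin–Pryadko Lemma 16 allows:
  `ker ℋ₁ = ker ℋ₂ = 0 ⇒ K = 0`) and the printed contrapositive **`KovalevPryadko2013_consequence4`**;
* **`KovalevPryadko2013_theorem5`**: every `D` with `c (D − 1) < d`, `d = min(d(ker ℋ₁), d(ker ℋ₂), d(ker ℋ₁ᵀ), d(ker ℋ₂ᵀ))`,
  is a lower bound for the CSS distance of `code a b χ`; **`KovalevPryadko2013_theorem5_floor`**: the printed `D ≥ ⌊d/c⌋`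
  (when `d < ∞`; in fact `⌈d/c⌉`, as Lin–Pryadko state it).

No named facts, no instances.

## References (locators read on the page)
* [KovalevPryadko2013Hyperbicycle] arXiv:1212.6703: eq. (22) (chunk p0009 L50–75), Consequence 4 (p0011
  L72–80), Theorem 5 (p0011 L83–99).
* [LinPryadko2024] arXiv:2306.16400: Statement 12, Lemma 16 (tree `QuasiAbelianLPDistance.lean`).
* [PanteleevKalachev2022LP] arXiv:2012.04068 §III.E (chunk p0012 L61): hyperbicycle = LP (tree
  `TwoBlockLiftedProduct.lean`).
-/

namespace Literature.InformationTheory.QuantumCodes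

namespace Hyperbicycle

open Matrix
open scoped Kronecker
open Literature.InformationTheory.Coding (minDist minDist_reindex)

variable {c : ℕ} [NeZero c]
variable {R₁ N₁ R₂ N₂ : Type*} [Fintype R₁] [Fintype N₁] [Fintype R₂] [Fintype N₂]
  [DecidableEq R₁] [DecidableEq N₁] [DecidableEq R₂] [DecidableEq N₂]

/-! ### A reindexing lemma for kernels -/

/-- `d(ker M) ` is invariant under permuting rows and relabelling columns ("the rank of a matrix does not change
… under permutations of rows and columns"). [cite: KovalevPryadko2013Hyperbicycle, §IV.B proof of Thm 3 (arXiv:1212.6703 chunk p0011 L57–60)] -/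
theorem minDist_pcCode_submatrix {r r' q q' : Type*} [Fintype r] [Fintype r'] [Fintype q] [Fintype q']
    [DecidableEq q] [DecidableEq q'] (M : Matrix r q (ZMod 2)) (ρ : r' ≃ r) (σ : q' ≃ q) :
    minDist (pcCode (M.submatrix ρ σ)) = minDist (pcCode M) := by
  have h1 : M.submatrix ρ σ = (M.submatrix ρ id).submatrix id σ := rfl
  have h2 : pcCode ((M.submatrix ρ id).submatrix id σ) = Coding.reindex σ.symm (pcCode (M.submatrix ρ id)) := by
    ext e
    rw [mem_pcCode_submatrix_iff, Coding.mem_reindex_iff]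
    rfl
  rw [h1, h2, minDist_reindex, pcCode_submatrix_equiv_rows]

/-- `ker M = 0` is invariant under permuting rows and relabelling columns. [cite: KovalevPryadko2013Hyperbicycle, §IV.B proof of Thm 3 (arXiv:1212.6703 chunk p0011 L57–60)] -/
theorem pcCode_submatrix_eq_bot {r r' q q' : Type*} [Fintype r] [Fintype r'] [Fintype q] [Fintype q']
    [DecidableEq q] [DecidableEq q'] (M : Matrix r q (ZMod 2)) (ρ : r' ≃ r) (σ : q' ≃ q) (h : pcCode M = ⊥) :
    pcCode (M.submatrix ρ σ) = ⊥ := by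
  have h1 : M.submatrix ρ σ = (M.submatrix ρ id).submatrix id σ := rfl
  have h2 : pcCode ((M.submatrix ρ id).submatrix id σ) = Coding.reindex σ.symm (pcCode (M.submatrix ρ id)) := by
    ext e
    rw [mem_pcCode_submatrix_iff, Coding.mem_reindex_iff]
    rfl
  rw [h1, h2, pcCode_submatrix_equiv_rows, h]
  exact Submodule.map_bot _

/-! ### The circulant blocks of `LP(A, B_χ)` and the tiled matrices (22) -/

/-- First rows of the circulant blocks `A_{uv} = Σᵢ (aᵢ)_{uv} xⁱ` (tree convention `circulant v i j = v (i − j)`,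
so the first row is `s ↦ (a_{−s})_{uv}`). [cite: PanteleevKalachev2022LP, §III.E (arXiv:2012.04068 chunk p0012 L61)] -/
def blocksA (a : ZMod c → Matrix R₁ N₁ (ZMod 2)) : R₁ → N₁ → ZMod c → ZMod 2 := fun u v s => a (-s) u v

/-- First rows of the twisted circulant blocks `(B_χ)_{βν} = Σᵢ (bᵢ)_{βν} x^{χi}`.
[cite: KovalevPryadko2013Hyperbicycle, §IV.A eq. (19) and §IV.F (arXiv:1212.6703 chunk p0009 L15–33)] -/
def blocksB (b : ZMod c → Matrix R₂ N₂ (ZMod 2)) (χ : (ZMod c)ˣ) : R₂ → N₂ → ZMod c → ZMod 2 :=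
  fun β ν s => b (↑χ⁻¹ * (-s)) β ν

/-- **`ℋ₁ = Σᵢ Iᵢ ⊗ aᵢ`** (rows `(k,u) ∈ ℤ_c × R₁`, columns `(j,v) ∈ ℤ_c × N₁`, entry `(a_{j−k})_{uv}`).
[cite: KovalevPryadko2013Hyperbicycle, eq. (22) (arXiv:1212.6703 chunk p0009 L50–75)] -/
def tiledA (a : ZMod c → Matrix R₁ N₁ (ZMod 2)) : Matrix (ZMod c × R₁) (ZMod c × N₁) (ZMod 2) :=
  Matrix.of fun x y => a (y.1 - x.1) x.2 y.2

/-- **`ℋ₂ = Σᵢ bᵢ ⊗ I_{χi}`** (rows `(β,k) ∈ R₂ × ℤ_c`, columns `(ν,j) ∈ N₂ × ℤ_c`, entry `(b_{χ⁻¹(j−k)})_{βν}`;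
`χ = 1`: the printed `Σᵢ bᵢ ⊗ Iᵢ`). [cite: KovalevPryadko2013Hyperbicycle, eq. (22) (arXiv:1212.6703 chunk p0009 L50–75)] -/
def tiledB (b : ZMod c → Matrix R₂ N₂ (ZMod 2)) (χ : (ZMod c)ˣ) : Matrix (R₂ × ZMod c) (N₂ × ZMod c) (ZMod 2) :=
  Matrix.of fun x y => b (↑χ⁻¹ * (y.2 - x.2)) x.1 y.1

omit [Fintype R₁] [Fintype N₁] [Fintype R₂] [Fintype N₂] [DecidableEq R₁] [DecidableEq N₁]
  [DecidableEq R₂] [DecidableEq N₂] in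
/-- Faithfulness: `tiledA a` IS the Kronecker sum `Σᵢ Iᵢ ⊗ aᵢ`. [cite: KovalevPryadko2013Hyperbicycle, eq. (22) (arXiv:1212.6703 chunk p0009 L50–58)] -/
theorem tiledA_eq_kronecker (a : ZMod c → Matrix R₁ N₁ (ZMod 2)) :
    tiledA a = ∑ i : ZMod c, cycPerm i ⊗ₖ a i := by
  ext ⟨k, u⟩ ⟨j, v⟩
  simp only [tiledA, of_apply, Matrix.sum_apply, kroneckerMap_apply, cycPerm_apply, ite_mul, one_mul, zero_mul]
  rw [Finset.sum_eq_single (j - k)]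
  · rw [if_pos (by abel)]
  · intro i _ hi
    exact if_neg fun h' => hi (by rw [h', add_sub_cancel_left])
  · intro h'
    exact absurd (Finset.mem_univ _) h'

omit [Fintype R₁] [Fintype N₁] [Fintype R₂] [Fintype N₂] [DecidableEq R₁] [DecidableEq N₁]
  [DecidableEq R₂] [DecidableEq N₂] in
/-- Faithfulness: `tiledB b χ` IS the Kronecker sum `Σᵢ bᵢ ⊗ I_{χi}`. [cite: KovalevPryadko2013Hyperbicycle, eq. (22) (arXiv:1212.6703 chunk p0009 L50–58)] -/
theorem tiledB_eq_kronecker (b : ZMod c → Matrix R₂ N₂ (ZMod 2)) (χ : (ZMod c)ˣ) :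
    tiledB b χ = ∑ i : ZMod c, b i ⊗ₖ cycPerm ((χ : ZMod c) * i) := by
  ext ⟨β, k⟩ ⟨ν, j⟩
  simp only [tiledB, of_apply, Matrix.sum_apply, kroneckerMap_apply, cycPerm_apply, mul_ite, mul_one, mul_zero]
  rw [sum_ite_eq_add_mul χ k j (fun i => b i β ν)]

omit [NeZero c] [Fintype R₁] [Fintype N₁] [Fintype R₂] [Fintype N₂] [DecidableEq R₁] [DecidableEq N₁]
  [DecidableEq R₂] [DecidableEq N₂] in
/-- `𝔅(A)` is `ℋ₁` with the index pairs swapped: `𝔅(A)_{(u,k),(v,j)} = (a_{j−k})_{uv}`.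
[cite: KovalevPryadko2013Hyperbicycle, eq. (21)–(22) (arXiv:1212.6703 chunk p0009 L50–75)] -/
theorem flat_blocksA (a : ZMod c → Matrix R₁ N₁ (ZMod 2)) :
    LiftedProduct.flat (blocksA a) = (tiledA a).submatrix (Equiv.prodComm _ _) (Equiv.prodComm _ _) := by
  ext ⟨u, k⟩ ⟨v, j⟩
  simp [blocksA, tiledA, neg_sub]

omit [NeZero c] [Fintype R₁] [Fintype N₁] [Fintype R₂] [Fintype N₂] [DecidableEq R₁] [DecidableEq N₁]
  [DecidableEq R₂] [DecidableEq N₂] in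
/-- `𝔅(B_χ) = ℋ₂` on the nose. [cite: KovalevPryadko2013Hyperbicycle, eq. (21)–(22) (arXiv:1212.6703 chunk p0009 L50–75)] -/
theorem flat_blocksB (b : ZMod c → Matrix R₂ N₂ (ZMod 2)) (χ : (ZMod c)ˣ) :
    LiftedProduct.flat (blocksB b χ) = tiledB b χ := by
  ext ⟨β, k⟩ ⟨ν, j⟩
  simp [blocksB, tiledB, neg_sub]

/-! ### The concrete identification `code a b χ ≅ LP(A, B_χ)` -/

/-- Row relabelling of the `X`-checks: `((u, β), k) ↦ (β, k, u)`. [cite: PanteleevKalachev2022LP, §III.E (arXiv:2012.04068 chunk p0012 L61)] -/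
def rowEquivX : (R₁ × R₂) × ZMod c ≃ R₂ × ZMod c × R₁ where
  toFun p := (p.1.2, p.2, p.1.1)
  invFun r := ((r.2.2, r.1), r.2.1)
  left_inv _ := rfl
  right_inv _ := rfl

/-- Row relabelling of the `Z`-checks: `((μ, ν), k') ↦ (ν, k', μ)`. [cite: PanteleevKalachev2022LP, §III.E (arXiv:2012.04068 chunk p0012 L61)] -/
def rowEquivZ : (N₁ × N₂) × ZMod c ≃ N₂ × ZMod c × N₁ where
  toFun p := (p.1.2, p.2, p.1.1)
  invFun r := ((r.2.2, r.1), r.2.1)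
  left_inv _ := rfl
  right_inv _ := rfl

/-- Qubit relabelling: `(inl (v, β), j) ↦ inl (β, j, v)`, `(inr (u, ν), j) ↦ inr (ν, j, u)`.
[cite: PanteleevKalachev2022LP, §III.E (arXiv:2012.04068 chunk p0012 L61)] -/
def qubitEquiv : ((N₁ × R₂) ⊕ (R₁ × N₂)) × ZMod c ≃ (R₂ × ZMod c × N₁) ⊕ (N₂ × ZMod c × R₁) where
  toFun p := match p with
    | (Sum.inl (v, β), j) => Sum.inl (β, j, v)
    | (Sum.inr (u, ν), j) => Sum.inr (ν, j, u)
  invFun q := match q with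
    | Sum.inl (β, j, v) => (Sum.inl (v, β), j)
    | Sum.inr (ν, j, u) => (Sum.inr (u, ν), j)
  left_inv p := by rcases p with ⟨⟨v, β⟩ | ⟨u, ν⟩, j⟩ <;> rfl
  right_inv q := by rcases q with ⟨β, j, v⟩ | ⟨ν, j, u⟩ <;> rfl

omit [Fintype R₁] [Fintype N₁] [Fintype R₂] [Fintype N₂] [DecidableEq N₁] [DecidableEq N₂] in
/-- **`G_X ≅ 𝔅(H_X(A, B_χ))`**: the hyperbicycle `X`-matrix, relabelled, is the lifted-product `X`-matrix of the
circulant blocks. [cite: PanteleevKalachev2022LP, §III.E (arXiv:2012.04068 chunk p0012 L61: «QC LP codes are permutation equivalent to a special case of hyperbicycle codes»)]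
[cite: KovalevPryadko2013Hyperbicycle, §IV.A eq. (19) (arXiv:1212.6703 chunk p0009 L15–42)] -/
theorem xMatrix_submatrix (a : ZMod c → Matrix R₁ N₁ (ZMod 2)) (b : ZMod c → Matrix R₂ N₂ (ZMod 2))
    (χ : (ZMod c)ˣ) :
    (xMatrix a b χ).submatrix rowEquivX qubitEquiv =
      LiftedProduct.xMatrix (fun u v => circulant (blocksA a u v)) (fun β ν => circulant (blocksB b χ β ν)) := by
  have hneg : ∀ x : ZMod 2, -x = x := by decide
  rw [LiftedProduct.xMatrix_eq_of_xEntry]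
  ext ⟨⟨u, β⟩, k⟩ ⟨q, j⟩
  rcases q with ⟨v, β'⟩ | ⟨u', ν⟩
  · simp [xMatrix, xLeft, LiftedProduct.xEntry, rowEquivX, qubitEquiv, blocksA, circulant_apply, neg_sub]
  · simp [xMatrix, xRight, LiftedProduct.xEntry, rowEquivX, qubitEquiv, blocksB, circulant_apply, neg_sub, hneg]

omit [Fintype R₁] [Fintype N₁] [Fintype R₂] [Fintype N₂] [DecidableEq R₁] [DecidableEq R₂] in
/-- **`G_Z ≅ 𝔅(H_Z(A, B_χ))`**. [cite: PanteleevKalachev2022LP, §III.E (arXiv:2012.04068 chunk p0012 L61)]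
[cite: KovalevPryadko2013Hyperbicycle, §IV.A eq. (19) (arXiv:1212.6703 chunk p0009 L15–42)] -/
theorem zMatrix_submatrix (a : ZMod c → Matrix R₁ N₁ (ZMod 2)) (b : ZMod c → Matrix R₂ N₂ (ZMod 2))
    (χ : (ZMod c)ˣ) :
    (zMatrix a b χ).submatrix rowEquivZ qubitEquiv =
      LiftedProduct.zMatrix (fun u v => circulant (blocksA a u v)) (fun β ν => circulant (blocksB b χ β ν)) := by
  rw [LiftedProduct.zMatrix_eq_of_zEntry]
  ext ⟨⟨μ, ν⟩, k⟩ ⟨q, j⟩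
  rcases q with ⟨v, β'⟩ | ⟨u', ν'⟩
  · simp [zMatrix, zLeft, LiftedProduct.zEntry, rowEquivZ, qubitEquiv, blocksB, circulant_apply, neg_sub]
  · simp [zMatrix, zRight, LiftedProduct.zEntry, rowEquivZ, qubitEquiv, blocksA, circulant_apply, neg_sub]

/-- **The lifted-product presentation `LP(A, B_χ)` of the hyperbicycle code**, as a `CSSCode` (commutation
inherited from `code a b χ`). [cite: PanteleevKalachev2022LP, §III.E (arXiv:2012.04068 chunk p0012 L61)] -/
def lpCode (a : ZMod c → Matrix R₁ N₁ (ZMod 2)) (b : ZMod c → Matrix R₂ N₂ (ZMod 2)) (χ : (ZMod c)ˣ) :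
    CSSCode ((R₁ × R₂) × ZMod c) ((N₁ × N₂) × ZMod c) (((N₁ × R₂) ⊕ (R₁ × N₂)) × ZMod c) where
  HX := LiftedProduct.xMatrix (fun u v => circulant (blocksA a u v)) (fun β ν => circulant (blocksB b χ β ν))
  HZ := LiftedProduct.zMatrix (fun u v => circulant (blocksA a u v)) (fun β ν => circulant (blocksB b χ β ν))
  comm := by
    rw [← xMatrix_submatrix, ← zMatrix_submatrix, transpose_submatrix, submatrix_mul_equiv,
      show xMatrix a b χ * (zMatrix a b χ)ᵀ = 0 from (code a b χ).comm, submatrix_zero, Pi.zero_def, Pi.zero_def]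

/-- `lpCode` has the same number of logical qubits as `code a b χ` (FACT P).
[cite: PanteleevKalachev2022LP, §III.E (arXiv:2012.04068 chunk p0012 L61)] -/
theorem lpCode_k (a : ZMod c → Matrix R₁ N₁ (ZMod 2)) (b : ZMod c → Matrix R₂ N₂ (ZMod 2)) (χ : (ZMod c)ˣ) :
    (lpCode a b χ).k = (code a b χ).k :=
  CSSCode.k_eq_of_submatrix (C' := lpCode a b χ) (C := code a b χ) (xMatrix_submatrix a b χ).symm
    (zMatrix_submatrix a b χ).symm

/-- `lpCode` has the same CSS minimum distance as `code a b χ`.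
[cite: PanteleevKalachev2022LP, §III.E (arXiv:2012.04068 chunk p0012 L61)] -/
theorem cssMinDist_lpCode (a : ZMod c → Matrix R₁ N₁ (ZMod 2)) (b : ZMod c → Matrix R₂ N₂ (ZMod 2))
    (χ : (ZMod c)ˣ) :
    cssMinDist (lpCode a b χ).HX (lpCode a b χ).HZ = cssMinDist (xMatrix a b χ) (zMatrix a b χ) := by
  change cssMinDist (LiftedProduct.xMatrix (fun u v => circulant (blocksA a u v)) (fun β ν => circulant (blocksB b χ β ν)))
    (LiftedProduct.zMatrix (fun u v => circulant (blocksA a u v)) (fun β ν => circulant (blocksB b χ β ν))) = _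
  rw [← xMatrix_submatrix, ← zMatrix_submatrix,
    show (xMatrix a b χ).submatrix rowEquivX qubitEquiv =
      ((xMatrix a b χ).submatrix rowEquivX id).submatrix id qubitEquiv from rfl,
    show (zMatrix a b χ).submatrix rowEquivZ qubitEquiv =
      ((zMatrix a b χ).submatrix rowEquivZ id).submatrix id qubitEquiv from rfl,
    cssMinDist_submatrix_equiv, cssMinDist_submatrix_equiv_rows]

/-! ### Consequence 4 -/

/-- **Consequence 4 (sharp form, via Lin–Pryadko Lemma 16): `ker ℋ₁ = 0` and `ker ℋ₂ = 0` force `K = 0`**, for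
every twist `χ`. [cite: KovalevPryadko2013Hyperbicycle, Consequence 4 (arXiv:1212.6703 chunk p0011 L72–80)]
[cite: LinPryadko2024, Lemma 16 (arXiv:2306.16400 chunk p0019 L100–106)] -/
theorem k_eq_zero_of_pcCode_tiled_eq_bot (a : ZMod c → Matrix R₁ N₁ (ZMod 2))
    (b : ZMod c → Matrix R₂ N₂ (ZMod 2)) (χ : (ZMod c)ˣ) (hA : pcCode (tiledA a) = ⊥)
    (hB : pcCode (tiledB b χ) = ⊥) : (code a b χ).k = 0 := by
  rw [← lpCode_k]
  refine LiftedProduct.k_eq_zero_of_pcCode_eq_bot (blocksA a) (blocksB b χ) ?_ ?_ rfl rfl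
  · rw [flat_blocksA]; exact pcCode_submatrix_eq_bot _ _ _ hA
  · rw [flat_blocksB]; exact hB

/-- **Consequence 4 as printed**: "A quantum CSS code with generators (19) can only have `K > 0` if at least one of
the binary codes with the parity check matrices (22) is non-empty" — here for every twist `χ`, and already one
of `ker ℋ₁`, `ker ℋ₂` is nonzero. [cite: KovalevPryadko2013Hyperbicycle, Consequence 4 (arXiv:1212.6703 chunk p0011 L72–80)] -/
theorem KovalevPryadko2013_consequence4 (a : ZMod c → Matrix R₁ N₁ (ZMod 2)) (b : ZMod c → Matrix R₂ N₂ (ZMod 2)) (χ : (ZMod c)ˣ)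
    (hk : 0 < (code a b χ).k) : pcCode (tiledA a) ≠ ⊥ ∨ pcCode (tiledB b χ) ≠ ⊥ := by
  by_contra h
  simp only [not_or, not_not] at h
  exact hk.ne' (k_eq_zero_of_pcCode_tiled_eq_bot a b χ h.1 h.2)

/-! ### Theorem 5 -/

/-- The four classical distances of Theorem 5, in the tree's conventions:
`d = min(d(ker ℋ₁), d(ker ℋ₂), d(ker ℋ₁ᵀ), d(ker ℋ₂ᵀ))`. [cite: KovalevPryadko2013Hyperbicycle, Thm 5 (arXiv:1212.6703 chunk p0011 L83–88)] -/
noncomputable def tiledDist (a : ZMod c → Matrix R₁ N₁ (ZMod 2)) (b : ZMod c → Matrix R₂ N₂ (ZMod 2))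
    (χ : (ZMod c)ˣ) : ℕ∞ :=
  min (min (minDist (pcCode (tiledA a))) (minDist (pcCode (tiledB b χ))))
    (min (minDist (pcCode (tiledA a)ᵀ)) (minDist (pcCode (tiledB b χ)ᵀ)))

/-- **Theorem 5 (Kovalev–Pryadko 2013), for every twist `χ`**: if `c (D − 1) < d` then `D` is a lower bound for
the minimum distance of the hyperbicycle code — `D ≤ cssMinDist G_X G_Z`.
[cite: KovalevPryadko2013Hyperbicycle, Thm 5 (arXiv:1212.6703 chunk p0011 L83–99)]
[cite: LinPryadko2024, Statement 12 (arXiv:2306.16400 chunk p0011 L101–110)] -/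
theorem KovalevPryadko2013_theorem5 (a : ZMod c → Matrix R₁ N₁ (ZMod 2)) (b : ZMod c → Matrix R₂ N₂ (ZMod 2)) (χ : (ZMod c)ˣ)
    (D : ℕ) (hD : ((c * (D - 1) : ℕ) : ℕ∞) < tiledDist a b χ) :
    (D : ℕ∞) ≤ cssMinDist (xMatrix a b χ) (zMatrix a b χ) := by
  rw [← cssMinDist_lpCode]
  have h := LiftedProduct.le_cssMinDist_of_card_mul_lt (F := ZMod 2) (blocksA a) (blocksB b χ) D ?_
  · exact h
  rw [ZMod.card, flat_blocksA, flat_blocksB, transpose_submatrix, minDist_pcCode_submatrix,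
    minDist_pcCode_submatrix]
  exact hD

/-- **Theorem 5 as printed: `D ≥ ⌊d/c⌋`** (for finite `d`; the sharper `⌈d/c⌉` is `KovalevPryadko2013_theorem5` with
`D = ⌈d/c⌉`). [cite: KovalevPryadko2013Hyperbicycle, Thm 5 (arXiv:1212.6703 chunk p0011 L83–88: «D ≥ ⌊d/c⌋, d ≡ min(d₁,d₂,d̃₁,d̃₂)»)] -/
theorem KovalevPryadko2013_theorem5_floor (a : ZMod c → Matrix R₁ N₁ (ZMod 2)) (b : ZMod c → Matrix R₂ N₂ (ZMod 2))
    (χ : (ZMod c)ˣ) (d : ℕ) (hd : tiledDist a b χ = d) :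
    ((d / c : ℕ) : ℕ∞) ≤ cssMinDist (xMatrix a b χ) (zMatrix a b χ) := by
  rcases Nat.eq_zero_or_pos (d / c) with h0 | hpos
  · rw [h0, Nat.cast_zero]; exact bot_le
  · refine KovalevPryadko2013_theorem5 a b χ (d / c) ?_
    rw [hd, Nat.cast_lt]
    have hc : 0 < c := Nat.pos_of_ne_zero (NeZero.ne c)
    have h1 : c * (d / c) ≤ d := Nat.mul_div_le d c
    have h2 : c * (d / c - 1) = c * (d / c) - c := Nat.mul_sub_one c (d / c)
    have h3 : c ≤ c * (d / c) := Nat.le_mul_of_pos_right c hpos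
    omega

end Hyperbicycle

end Literature.InformationTheory.QuantumCodes
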